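import Summits.BirchSwinnertonDyer.BirchSwinnertonDyer.Theorems.EisensteinPrimesMazurMCOnCellBTwistbackOnePartner
import Summits.BirchSwinnertonDyer.BirchSwinnertonDyer.Theorems.EisensteinPrimesMazurMCOnCellBTwistbackKnotThmD
import Summits.BirchSwinnertonDyer.BirchSwinnertonDyer.Theorems.EisensteinPrimesBSDpOnCellCTwistCertificate
import HarnessLib

/-!
# Crux 3 `MazurMCOnCellB` (stmt-BirchSwinnertonDyer-19033), line `twistback` v5/v6 — the PER-PAIR CORE with every Heegner
# datum DISCHARGED: `BSD(E,p)` / Mazur's main conjecture at an X2b pair `(W, p)` from ONE admissible `K` and the upper half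
# (or `BSD_p`) at ONE globally minimal model of the partner `E^{(d_K)}`; and the TWO-STEP TRANSFER (a `BSD_p` / main
# conjecture two admissible twists away propagates back to `(W, p)`), both signs at `p`, every odd `p`

Width seat bsd-line-x2-p1-w6 (gen 2), cell `bsd-eis`, 2026-08-28; `--supports stmt-BirchSwinnertonDyer-19033 --as helper`;
companion of `…TwistbackTwoStepShaUnit` (same seat; the UNIT specialisation of §2 below). HONEST FRAMING: conditional
theorems only; no `def`, no named fact introduced, no `sorry`; closes no registered stub; no summit statement, no Mazur main
conjecture and no BSD is proved for any curve unconditionally; 0 cells / labels / stubs / tiers move.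

## What

* §1 `bsdp_of_cellB_of_upper_partnerAt` / `mazurMainConjectureAt_of_cellB_of_upper_partnerAt` (+ `…_of_bsdp_partnerAt`):
  PER PAIR, at an X2b pair `(W, p)`: ONE admissible `K` (imaginary quadratic, Heegner for `N_W` and `p`, `d_K` odd `< −4`,
  `ord_{s=1} L(E^{(d_K)},s) = 1`) and `Typed.MissingUpperBoundAt Wd p` (resp. `BSDp Wd p`) at ONE globally minimal model
  `Wd` of `E^{(d_K)}` give `BSDp W p` and `X2.MazurMainConjectureAt W p`. This is LEAD g9's CLASS-WIDE composition
  p640326 §1 (`…TwistbackOnePartner.mazurMCOnCellB_of_indexLowerBoundRankZero_of_exists_upper_partner`) run at ONE pair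
  with the partner GIVEN: optimal curve `W₀ ∼ W` with a datum prime to `p` (`X2.exists_isIsogenous_hasPrimeToManinDatum`:
  Mazur Cor. 4.1 + Edixhoven + modularity), `X2.CellB W₀ p` (Tate facts discharged), `N_{W₀} = N_W`
  (`conductorNorm_eq_of_isIsogenous_of_modularity_of_isGloballyMinimal`), `E^{(d)} ∼ E₀^{(d)}` (`IsIsogenous.quadraticTwist`),
  Heegner datum + point (`exists_dvd_sq_sub_discr_holds`, `nonempty_heegnerDatum_holds`, Darmon Thm. 3.6), the upper half
  moved to a model of `E₀^{(d)}` by Cassels (`…TwistbackKnotThmD.missingUpperBoundAt_of_isIsogenous`), STEP L in the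
  rank-zero orientation from item -27489 ⟸ Keller–Yin Thm. D + Poitou–Tate ×2 + Hsieh + LZZ
  (`indexLowerBoundRankZero_of_kRankOne ∘ heegnerIndexIdentityKRankOne_of_thmD_OPEN_of_thm151_thm153`), LEAD g7's
  per-pair lower half p625263 §2, Cassels back, `X2.mazurMainConjectureAt_of_bsdp_of_red`. USE: the per-cell displays of
  row A10 (lam-a `…TwistbackDisplays01–09`, door p640749 §4) carry the Heegner datum `(Dt, H, ι, P, hPt, hcM)` and STEP L
  `hlow` as HYPOTHESES; through this core those seven binders become the named facts {Mazur 4.1, PT ×2, Hsieh, LZZ, KY Thm. D}.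
* §2 TWO-STEP TRANSFER `bsdp_partner_of_twoStepBSDp`, `bsdp_of_cellB_of_twoStepBSDp`,
  `mazurMainConjectureAt_of_cellB_of_twoStep_mazurMainConjectureAt`: with a SECOND admissible `K″` for `Wd`
  (`L(Wd^{(d_{K″})},1) ≠ 0`) and a globally minimal model `W″` of `Wd^{(d_{K″})}` (an X2 rank-zero curve, X2b-type again),
  `BSDp W″ p` (resp. `X2.MazurMainConjectureAt W″ p`) ⟹ `BSDp Wd p` (crux 4's TWIST-PARTNER door
  `Reoriented.bsdp_of_cellC_of_twistPartnerBSDp`, p517406, value atom from LZZ, IMC atoms from Thm. D) ⟹ `BSDp W p` /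
  the main conjecture at `(W, p)` (§1) = the edge of idea-12's `anchor` graph (`Lines/anchor.lean`, LEAD g7 UnitLever §4
  p627870) with STEP L, co-STEP L and both Heegner data DISCHARGED. The UNIT anchor (`ord_p #Ш_an(W″) = 0`, Wuthrich
  Prop. 21) is the companion file.

HYPOTHESES BY NAME (nothing asserted): `PublishedInputs` (stmt-…-19037), Poitou–Tate ×2, Hsieh 2014 Thm. 1, Liu–Zhang–Zhang
2018, Mazur 1978 Cor. 4.1 (PUBLISHED / refereed; conjuncts of stubs 1–2), Keller–Yin 2024 Thm. D (stub 3a; UNREFEREED PREPRINT).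
PER PAIR: fields, models, readings as displayed. Nothing class-wide is claimed; the existence of admissible `K` with a closed
partner at every X2b pair is the registered OPEN stub 6′.

References: [CastellaEtAl2021] Thm. 5.3.1; [JetchevSkinnerWan2017] §7.4.1; [KellerYin2024] Thm. D (PRE); [LiuZhangZhang2018];
[Hsieh2014] Thm. 1; [Wuthrich2014] Thm. 16; [Mazur1978] Cor. 4.1; [Darmon2004] Thm. 3.6; [MilneADT2006] Thm. I.7.3;
[Miller2011LMS] Def. 1.1.
-/

set_option autoImplicit false
-- `Summit.BirchSwinnertonDyer.BirchSwinnertonDyer.…`: the summit and its single sub-problem share a name.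
set_option linter.dupNamespace false

noncomputable section

open scoped Classical MatrixGroups ModularForm

open CongruenceSubgroup WeierstrassCurve NumberField
  Literature.NumberTheory.EllipticCurves
  Literature.NumberTheory.EllipticCurves.ModularForms
  Literature.NumberTheory.QuadraticFields
  Literature.NumberTheory.EllipticCurves.Rank1Residual
  Literature.NumberTheory.EllipticCurves.Rank1Residual.Typed
  Literature.NumberTheory.EllipticCurves.Wuthrich2014
  Literature.NumberTheory.EllipticCurves.SteinWuthrich2013
  Literature.NumberTheory.EllipticCurves.GreenbergVatsal2000
  Literature.NumberTheory.EllipticCurves.KellerYin2024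
  Literature.NumberTheory.GaloisCohomology
  Summit.BirchSwinnertonDyer.Rank1Residual
  Summit.BirchSwinnertonDyer.BirchSwinnertonDyer.Theses
  Summit.BirchSwinnertonDyer.BirchSwinnertonDyer.Theorems.EisensteinPrimesMazurMCOnCellBTwistbackLowerHalf
  Summit.BirchSwinnertonDyer.BirchSwinnertonDyer.Theorems.EisensteinPrimesMazurMCOnCellBTwistbackLowerHalfByName
  Summit.BirchSwinnertonDyer.BirchSwinnertonDyer.Theorems.EisensteinPrimesMazurMCOnCellBTwistbackValueOfLZZByName

namespace Summit.BirchSwinnertonDyer.BirchSwinnertonDyer.Theorems.EisensteinPrimesMazurMCOnCellBTwistbackOnePartnerAt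

/-! ## §1. Per pair: ONE admissible `K` + the upper half at ONE model of the partner ⟹ `BSD(E,p)` and the main conjecture -/

/-- **PER-PAIR CORE: `BSD(E,p)` at an X2b pair from ONE admissible field and the UPPER half at ONE globally minimal model of
the partner, every Heegner datum DISCHARGED.** Data: `X2.CellB W p`; `K` imaginary quadratic, Heegner for `N_W` and for `p`,
`d_K` odd `< −4`, `ord_{s=1} L(E^{(d_K)}, s) = 1`; `Wd` a globally minimal model of `E^{(d_K)}` with
`Typed.MissingUpperBoundAt Wd p`. Named facts BY NAME: `PublishedInputs` (Cassels, parametrisation, newforms, Gross–Zagier,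
Kolyvagin, GZK, Wuthrich Thm. 16, Stein–Wuthrich, heights, Greenberg–Stevens are the conjuncts used), Poitou–Tate ×2, Hsieh,
Liu–Zhang–Zhang, Mazur Cor. 4.1, Keller–Yin Thm. D (PRE; STEP L = item -27489 in the rank-zero orientation via
`indexLowerBoundRankZero_of_kRankOne ∘ heegnerIndexIdentityKRankOne_of_thmD_OPEN_of_thm151_thm153`). Proof = p640326 §1 at
one pair: optimal curve `W₀ ∼ W` with `p ∤ c` (`X2.exists_isIsogenous_hasPrimeToManinDatum`), `K` admissible for `W₀`
(`conductorNorm_eq_of_isIsogenous_…`), `r_an(E₀^{(d_K)}) = 1` (`IsIsogenous.quadraticTwist`), Heegner datum and point (Darmon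
Thm. 3.6), a minimal model `Wd₀` of `E₀^{(d_K)}` with the upper half moved from `Wd` (`missingUpperBoundAt_of_isIsogenous`),
p625263 §2 at `W₀`, `BSDp W₀ p`, Cassels to `W`. CONDITIONAL; nothing about any curve is proved unconditionally.
[claim: KellerYin2024, status: under-review] [cite: KellerYin2024, Thm. D = Thm. 5.1.3 (arXiv:2402.12781v2 L306–L309)]
[cite: JetchevSkinnerWan2017, §7.4.1 (eq:shalowerK-1)] [cite: Wuthrich2014, Thm. 16 (p. 397)] [cite: Mazur1978, Cor. 4.1]
[cite: Darmon2004, Thm. 3.6] [cite: MilneADT2006, Thm. I.7.3] [cite: Miller2011LMS, Def. 1.1] -/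
theorem bsdp_of_cellB_of_upper_partnerAt (hP : EisensteinPrimes.PublishedInputs)
    (hPT : ∀ (K : Type) [Field K] [NumberField K], poitouTate_selmerStructure_duality K)
    (hPT2 : ∀ (K : Type) [Field K] [NumberField K], poitouTate_sha_tateDual K)
    (hH : hsieh2014_exists_anticyclotomicPAdicLFunction)
    (hF : LiuZhangZhang2018.thm151_thm153_modularCurve_heegnerVector) (hMaz : mazur_not_dvd_maninConstant_of_odd)
    (hD : KellerYin2024.thmD_imcMult_exists_isBDPLFunction_isTorsion_charIdeal_eq_OPEN)
    (W : WeierstrassCurve ℚ) [W.IsElliptic] [W.IsGloballyMinimal] (p : ℕ) [Fact p.Prime] (hc : X2.CellB W p)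
    (K : Type) [Field K] [NumberField K] (hK : IsImaginaryQuadratic K)
    (hHN : SatisfiesHeegnerHypothesis (W.conductorNorm ℤ) K) (hHp : SatisfiesHeegnerHypothesis p K)
    (hoddK : Odd (NumberField.discr K)) (hlt : NumberField.discr K < -4)
    (hr1 : (W.quadraticTwist (NumberField.discr K : ℚ)).analyticRank = 1)
    (Wd : WeierstrassCurve ℚ) [Wd.IsElliptic] [Wd.IsGloballyMinimal]
    (hWd : ∃ C : VariableChange ℚ, C • Wd = W.quadraticTwist (NumberField.discr K : ℚ))
    (hUd : MissingUpperBoundAt Wd p) : BSDp W p := by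
  have hCassels := hP.2.1
  have hpar := hP.2.2.2.2.1
  have hnf := hP.2.2.2.2.2.1
  have hGZ := hP.2.2.2.2.2.2.2.2.1
  have hKo := hP.2.2.2.2.2.2.2.2.2.1
  have hGZK := hP.2.2.2.2.2.2.2.2.2.2.1
  have hWu := hP.2.2.2.2.2.2.2.2.2.2.2.2.2.2.1
  have hJs := hP.2.2.2.2.2.2.2.2.2.2.2.2.2.2.2.1
  have hJn := hP.2.2.2.2.2.2.2.2.2.2.2.2.2.2.2.2.1
  have hHs := hP.2.2.2.2.2.2.2.2.2.2.2.2.2.2.2.2.2.1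
  have hHn := hP.2.2.2.2.2.2.2.2.2.2.2.2.2.2.2.2.2.2.1
  have hGS := hP.2.2.2.2.2.2.2.2.2.2.2.2.2.2.2.2.2.2.2
  have hE : WeierstrassCurve.hasEntireLFunction_rat :=
    WeierstrassCurve.hasEntireLFunction_rat_of_exists_isNewformOf hnf
  have hHP : ∀ (N : ℕ) [NeZero N] (W : WeierstrassCurve ℚ) (K : Type) [Field K] [NumberField K],
      heegnerPointComplex_mem_range_map N W K :=
    fun N _ W K _ _ ↦ heegnerPointComplex_mem_range_map_holds N W K
  have hEd : edixhoven_optimalManinConstant_integral :=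
    ModularForms.edixhoven_optimalManinConstant_integral_holds
  -- STEP L in the rank-zero orientation: item -27489 from Thm. D (+ PT ×2, Hsieh, LZZ)
  have hSL0 := indexLowerBoundRankZero_of_kRankOne
    (heegnerIndexIdentityKRankOne_of_thmD_OPEN_of_thm151_thm153 hP hPT hPT2 hH hF hD)
  have hp2 : p ≠ 2 := hc.2.1.1
  have hred : ¬ W.HasIrreducibleModPGaloisRep p := hc.2.1.2.1
  have hmult : W.HasMultiplicativeReductionAtPrime p := hc.2.1.2.2
  have hr : W.analyticRank = 0 := hc.1
  ---------------------------------------------------------------- the given model of the partner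
  obtain ⟨C, hC⟩ := hWd
  have hd0 : (NumberField.discr K : ℚ) ≠ 0 := by exact_mod_cast NumberField.discr_ne_zero K
  haveI := W.isElliptic_quadraticTwist hd0
  have hrd : Wd.analyticRank = 1 := by
    have h := congrArg WeierstrassCurve.analyticRank hC
    rw [analyticRank_smul] at h
    exact h.trans hr1
  ---------------------------------------------------------------- the optimal curve `W₀ ∼ W` with `p ∤ c`
  obtain ⟨W₀, hE₀, hM₀, hiso, hMan⟩ :=
    X2.exists_isIsogenous_hasPrimeToManinDatum hEd hMaz hpar hnf W p hp2 hmult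
  haveI := hE₀
  haveI := hM₀
  have hc₀ : X2.CellB W₀ p :=
    (X2.cellB_iff_of_isIsogenous (p := p) TateCurve.Silverman1994_thmV53_tateUniformisation_holds
      TateCurve.Silverman1994_thmV53_corV54_tateUniformisation_holds hiso).mp hc
  have hr₀ : W₀.analyticRank = 0 := hc₀.1
  have hred₀ : ¬ W₀.HasIrreducibleModPGaloisRep p := hc₀.2.1.2.1
  have hmult₀ : W₀.HasMultiplicativeReductionAtPrime p := hc₀.2.1.2.2
  haveI : NeZero (W₀.conductorNorm ℤ) := ⟨(W₀.conductorNorm_pos_holds).ne'⟩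
  obtain ⟨Dt, hcM⟩ := hMan
  ---------------------------------------------------------------- `K` is admissible for `W₀`
  have hN : W.conductorNorm ℤ = W₀.conductorNorm ℤ :=
    conductorNorm_eq_of_isIsogenous_of_modularity_of_isGloballyMinimal hpar hiso
  have hHN₀ : SatisfiesHeegnerHypothesis (W₀.conductorNorm ℤ) K := hN ▸ hHN
  haveI := W₀.isElliptic_quadraticTwist hd0
  have hisoT : IsIsogenous (W.quadraticTwist (NumberField.discr K : ℚ))
      (W₀.quadraticTwist (NumberField.discr K : ℚ)) := hiso.quadraticTwist hd0
  have h1₀ : (W₀.quadraticTwist (NumberField.discr K : ℚ)).analyticRank = 1 := by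
    rw [← analyticRank_eq_of_isIsogenous' hisoT]; exact hr1
  ---------------------------------------------------------------- the Heegner datum and its point
  obtain ⟨β, hβ⟩ := exists_dvd_sq_sub_discr_holds (W₀.conductorNorm ℤ) K hK hHN₀
  obtain ⟨H, -⟩ := nonempty_heegnerDatum_holds (W₀.conductorNorm ℤ) K hK hβ
  obtain ⟨ι⟩ : Nonempty (K →+* ℂ) := inferInstance
  obtain ⟨P, hPt⟩ := hHP (W₀.conductorNorm ℤ) W₀ K hK hHN₀ Dt H ι
  ---------------------------------------------------------------- a minimal model of `E₀^{(d_K)}`; its upper half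
  obtain ⟨Wd₀, _, _, C₀, hC₀⟩ := exists_isGloballyMinimal_smul_eq_quadraticTwist W₀ hd0
  have hrd₀ : Wd₀.analyticRank = 1 := by
    have h := congrArg WeierstrassCurve.analyticRank hC₀
    rw [analyticRank_smul] at h
    exact h.trans h1₀
  have hisod : IsIsogenous Wd₀ Wd :=
    ((isIsogenous_of_smul_eq hC₀).trans' hisoT.symm_of_charZero).trans' (isIsogenous_of_smul_eq' hC)
  have hUd₀ : MissingUpperBoundAt Wd₀ p :=
    EisensteinPrimesMazurMCOnCellBTwistbackKnotThmD.missingUpperBoundAt_of_isIsogenous hCassels hisod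
      (hGZK Wd (le_of_eq hrd)).2 (WeierstrassCurve.leadingLCoeff_ne_zero_holds (hE Wd)) hUd
  ---------------------------------------------------------------- p625263 §2 at `W₀`
  have hMC₀ : X2.MazurMainConjectureAt W₀ p :=
    mazurMainConjectureAt_of_indexLowerBoundAt_of_upper_twist hWu hJs hJn hHs hHn hGZK hE W₀ p (hGS W₀ p)
      (W₀.conductorNorm ℤ) K Dt H ι P (hGZ _ W₀ K) (hKo _ W₀ K) hK hoddK hlt rfl hHN₀ hHp hPt hcM hp2
      hmult₀ hred₀ hr₀ Wd₀ ⟨C₀, hC₀⟩ hrd₀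
      (hSL0 W₀ p (W₀.conductorNorm ℤ) K Dt H ι P hp2 hmult₀ hred₀ hr₀ rfl hK hoddK hlt hHN₀ h1₀ hPt hcM) hUd₀
  ---------------------------------------------------------------- `BSDp W₀ p`, Cassels to `W`
  have hbsdW₀ : BSDp W₀ p :=
    X2.bsdp_of_mazurMainConjectureAt_of_analyticRank_eq_zero hJs hJn hHs hHn hGZK hE hpar W₀ p (hGS W₀ p)
      hp2 hmult₀ hr₀ hMC₀
  exact X2.bsdp_of_isIsogenous_of_bsdp hCassels hGZK hE W₀ W hiso.symm_of_charZero p (by rw [hr₀]; omega)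
    hbsdW₀

/-- **PER PAIR: Mazur's main conjecture at an X2b pair from ONE admissible `K` and the upper half at ONE model of the
partner** — `bsdp_of_cellB_of_upper_partnerAt` and the exact converse at an odd multiplicative reducible rank-`0` pair
(`X2.mazurMainConjectureAt_of_bsdp_of_red`). Same binders. CONDITIONAL; a main conjecture is proved for no curve by this.
[claim: KellerYin2024, status: under-review] [cite: Wuthrich2014, Thm. 16 and §5 (p. 397)]
[cite: GreenbergLNM1716, §4 (PDF pp. 112–113)] [cite: Miller2011LMS, Def. 1.1] -/
theorem mazurMainConjectureAt_of_cellB_of_upper_partnerAt (hP : EisensteinPrimes.PublishedInputs)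
    (hPT : ∀ (K : Type) [Field K] [NumberField K], poitouTate_selmerStructure_duality K)
    (hPT2 : ∀ (K : Type) [Field K] [NumberField K], poitouTate_sha_tateDual K)
    (hH : hsieh2014_exists_anticyclotomicPAdicLFunction)
    (hF : LiuZhangZhang2018.thm151_thm153_modularCurve_heegnerVector) (hMaz : mazur_not_dvd_maninConstant_of_odd)
    (hD : KellerYin2024.thmD_imcMult_exists_isBDPLFunction_isTorsion_charIdeal_eq_OPEN)
    (W : WeierstrassCurve ℚ) [W.IsElliptic] [W.IsGloballyMinimal] (p : ℕ) [Fact p.Prime] (hc : X2.CellB W p)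
    (K : Type) [Field K] [NumberField K] (hK : IsImaginaryQuadratic K)
    (hHN : SatisfiesHeegnerHypothesis (W.conductorNorm ℤ) K) (hHp : SatisfiesHeegnerHypothesis p K)
    (hoddK : Odd (NumberField.discr K)) (hlt : NumberField.discr K < -4)
    (hr1 : (W.quadraticTwist (NumberField.discr K : ℚ)).analyticRank = 1)
    (Wd : WeierstrassCurve ℚ) [Wd.IsElliptic] [Wd.IsGloballyMinimal]
    (hWd : ∃ C : VariableChange ℚ, C • Wd = W.quadraticTwist (NumberField.discr K : ℚ))
    (hUd : MissingUpperBoundAt Wd p) : X2.MazurMainConjectureAt W p := by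
  have hnf := hP.2.2.2.2.2.1
  have hGZK := hP.2.2.2.2.2.2.2.2.2.2.1
  have hWu := hP.2.2.2.2.2.2.2.2.2.2.2.2.2.2.1
  have hJs := hP.2.2.2.2.2.2.2.2.2.2.2.2.2.2.2.1
  have hJn := hP.2.2.2.2.2.2.2.2.2.2.2.2.2.2.2.2.1
  have hHs := hP.2.2.2.2.2.2.2.2.2.2.2.2.2.2.2.2.2.1
  have hHn := hP.2.2.2.2.2.2.2.2.2.2.2.2.2.2.2.2.2.2.1
  have hGS := hP.2.2.2.2.2.2.2.2.2.2.2.2.2.2.2.2.2.2.2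
  have hE : WeierstrassCurve.hasEntireLFunction_rat :=
    WeierstrassCurve.hasEntireLFunction_rat_of_exists_isNewformOf hnf
  exact X2.mazurMainConjectureAt_of_bsdp_of_red hWu hJs hJn hHs hHn hGZK hE W p (hGS W p) hc.2.1.1 hc.2.1.2.2
    hc.2.1.2.1 hc.1
    (bsdp_of_cellB_of_upper_partnerAt hP hPT hPT2 hH hF hMaz hD W p hc K hK hHN hHp hoddK hlt hr1 Wd hWd hUd)

/-- **PER PAIR, `BSD_p` form of the partner input**: as `bsdp_of_cellB_of_upper_partnerAt` with `BSDp Wd p` at the given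
model of the partner (`BSDp ⟹ MissingPPartAt ⟹ upper half`, `Ш(Wd)` finite by GZK). CONDITIONAL.
[claim: KellerYin2024, status: under-review] [cite: Miller2011LMS, Def. 1.1] [cite: MilneADT2006, Thm. I.7.3] -/
theorem bsdp_of_cellB_of_bsdp_partnerAt (hP : EisensteinPrimes.PublishedInputs)
    (hPT : ∀ (K : Type) [Field K] [NumberField K], poitouTate_selmerStructure_duality K)
    (hPT2 : ∀ (K : Type) [Field K] [NumberField K], poitouTate_sha_tateDual K)
    (hH : hsieh2014_exists_anticyclotomicPAdicLFunction)
    (hF : LiuZhangZhang2018.thm151_thm153_modularCurve_heegnerVector) (hMaz : mazur_not_dvd_maninConstant_of_odd)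
    (hD : KellerYin2024.thmD_imcMult_exists_isBDPLFunction_isTorsion_charIdeal_eq_OPEN)
    (W : WeierstrassCurve ℚ) [W.IsElliptic] [W.IsGloballyMinimal] (p : ℕ) [Fact p.Prime] (hc : X2.CellB W p)
    (K : Type) [Field K] [NumberField K] (hK : IsImaginaryQuadratic K)
    (hHN : SatisfiesHeegnerHypothesis (W.conductorNorm ℤ) K) (hHp : SatisfiesHeegnerHypothesis p K)
    (hoddK : Odd (NumberField.discr K)) (hlt : NumberField.discr K < -4)
    (hr1 : (W.quadraticTwist (NumberField.discr K : ℚ)).analyticRank = 1)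
    (Wd : WeierstrassCurve ℚ) [Wd.IsElliptic] [Wd.IsGloballyMinimal]
    (hWd : ∃ C : VariableChange ℚ, C • Wd = W.quadraticTwist (NumberField.discr K : ℚ))
    (hbsd : BSDp Wd p) : BSDp W p := by
  have hGZK := hP.2.2.2.2.2.2.2.2.2.2.1
  obtain ⟨C, hC⟩ := hWd
  have hrd : Wd.analyticRank = 1 := by
    have h := congrArg WeierstrassCurve.analyticRank hC
    rw [analyticRank_smul] at h
    exact h.trans hr1
  haveI : Finite Wd.sha := (hGZK Wd (le_of_eq hrd)).2
  exact bsdp_of_cellB_of_upper_partnerAt hP hPT hPT2 hH hF hMaz hD W p hc K hK hHN hHp hoddK hlt hr1 Wd ⟨C, hC⟩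
    (lower_and_upper_of_missingPPartAt Wd p (missingPPartAt_of_bsdp Wd p hbsd)).2

/-! ## §2. The TWO-STEP TRANSFER: `BSD_p` / the main conjecture two admissible twists away propagates back -/

/-- **The rank-one PARTNER inherits `BSD_p` from a rank-zero curve one admissible twist further.** Data: `(W, p)` an X2 pair;
`K` imaginary quadratic with `p` split; `Wd` a globally minimal model of `E^{(d_K)}` with `ord_{s=1} L(Wd,s) = 1`; `K″`
admissible FOR `Wd` (Heegner for `N_{Wd}` and for `p`, `d_{K″}` odd `< −4`, `L(Wd^{(d_{K″})},1) ≠ 0`); `W″` a globally minimal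
model of `Wd^{(d_{K″})}` with `BSDp W″ p`. Conclusion `BSDp Wd p`: crux 4's TWIST-PARTNER door
`Reoriented.bsdp_of_cellC_of_twistPartnerBSDp` (p517406) at the X2c pair `(Wd, p)` (`X2.classX2_twist`), value atom from LZZ
(`X2.bdpValueContinuousDisplayAt_of_lzzRoadInputIoo ∘ X2.lzzRoadInputIoo_of_thm151_thm153`), IMC atoms from Thm. D
(`X2.forall_{nonsplit,split}IMCEqOnTreeIntOther_of_thmD_OPEN`). CONDITIONAL on every listed binder.
[claim: KellerYin2024, status: under-review] [cite: KellerYin2024, Thm. D = Thm. 5.1.3 (arXiv:2402.12781v2 L306–L309)]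
[cite: LiuZhangZhang2018, Thms. 1.5.1 and 1.5.3 (Duke 167 pp. 748–749)] [cite: CastellaEtAl2021, Thm. 5.3.1 and (5.5)–(5.7)]
[cite: Hsieh2014, Thm. 1] [cite: Mazur1978, Cor. 4.1] [cite: Miller2011LMS, Def. 1.1] -/
theorem bsdp_partner_of_twoStepBSDp (hP : EisensteinPrimes.PublishedInputs)
    (hPT : ∀ (K : Type) [Field K] [NumberField K], poitouTate_selmerStructure_duality K)
    (hPT2 : ∀ (K : Type) [Field K] [NumberField K], poitouTate_sha_tateDual K)
    (hH : hsieh2014_exists_anticyclotomicPAdicLFunction)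
    (hF : LiuZhangZhang2018.thm151_thm153_modularCurve_heegnerVector) (hMaz : mazur_not_dvd_maninConstant_of_odd)
    (hD : KellerYin2024.thmD_imcMult_exists_isBDPLFunction_isTorsion_charIdeal_eq_OPEN)
    (W : WeierstrassCurve ℚ) [W.IsElliptic] [W.IsGloballyMinimal] (p : ℕ) [Fact p.Prime] (hX : ClassX2 W p)
    (K : Type) [Field K] [NumberField K] (hK : IsImaginaryQuadratic K) (hHp : SatisfiesHeegnerHypothesis p K)
    (Wd : WeierstrassCurve ℚ) [Wd.IsElliptic] [Wd.IsGloballyMinimal]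
    (hWd : ∃ C : VariableChange ℚ, C • Wd = W.quadraticTwist (NumberField.discr K : ℚ))
    (hrd : Wd.analyticRank = 1)
    (K'' : Type) [Field K''] [NumberField K''] (hK'' : IsImaginaryQuadratic K'')
    (hodd'' : Odd (NumberField.discr K'')) (hlt'' : NumberField.discr K'' < -4)
    (hHN'' : SatisfiesHeegnerHypothesis (Wd.conductorNorm ℤ) K'') (hHp'' : SatisfiesHeegnerHypothesis p K'')
    (hL'' : (Wd.quadraticTwist (NumberField.discr K'' : ℚ)).entireLFunction 1 ≠ 0)
    (W'' : WeierstrassCurve ℚ) [W''.IsElliptic] [W''.IsGloballyMinimal]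
    (hW'' : ∃ C : VariableChange ℚ, C • W'' = Wd.quadraticTwist (NumberField.discr K'' : ℚ))
    (hbsd'' : BSDp W'' p) : BSDp Wd p := by
  have hCassels := hP.2.1
  have hnf := hP.2.2.2.2.2.1
  have hGZ := hP.2.2.2.2.2.2.2.2.1
  have hKo := hP.2.2.2.2.2.2.2.2.2.1
  have hGZK := hP.2.2.2.2.2.2.2.2.2.2.1
  have hcd : X2.CellC Wd p := ⟨hrd, X2.classX2_twist W p hX K hK hHp Wd hWd⟩
  exact Reoriented.bsdp_of_cellC_of_twistPartnerBSDp Wd p hnf hPT hPT2 hH hGZ hKo hGZK hMaz hCassels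
    (fun W' _ _ _ ↦ X2.bdpValueContinuousDisplayAt_of_lzzRoadInputIoo (X2.lzzRoadInputIoo_of_thm151_thm153 hF) W' p)
    (fun W' _ _ hc' hns ↦ X2.forall_nonsplitIMCEqOnTreeIntOther_of_thmD_OPEN hD W' p hc' hns)
    (fun W' _ _ hc' hs ↦ X2.forall_splitIMCEqOnTreeIntOther_of_thmD_OPEN hD W' p hc' hs)
    hcd K'' hK'' hodd'' hlt'' hHN'' hHp'' hL'' W'' hW'' hbsd''

/-- **TWO-STEP TRANSFER of `BSD_p`**: at an X2b pair `(W, p)` with admissible `K` (`ord_{s=1} L(E^{(d_K)},s) = 1`), ONE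
model `Wd` of the partner, a second admissible `K″` for `Wd` and a globally minimal model `W″` of `Wd^{(d_{K″})}`:
`BSDp W″ p ⟹ BSDp W p` (`bsdp_partner_of_twoStepBSDp` then §1). = the edge of idea-12's `anchor` graph / LEAD g7 UnitLever
§3–§4 (p627870) with STEP L, co-STEP L and both Heegner data DISCHARGED. CONDITIONAL on the named facts.
[claim: KellerYin2024, status: under-review] [cite: KellerYin2024, Thm. D = Thm. 5.1.3 (arXiv:2402.12781v2 L306–L309)]
[cite: CastellaEtAl2021, Thm. 5.3.1] [cite: MilneADT2006, Thm. I.7.3] [cite: Miller2011LMS, Def. 1.1] -/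
theorem bsdp_of_cellB_of_twoStepBSDp (hP : EisensteinPrimes.PublishedInputs)
    (hPT : ∀ (K : Type) [Field K] [NumberField K], poitouTate_selmerStructure_duality K)
    (hPT2 : ∀ (K : Type) [Field K] [NumberField K], poitouTate_sha_tateDual K)
    (hH : hsieh2014_exists_anticyclotomicPAdicLFunction)
    (hF : LiuZhangZhang2018.thm151_thm153_modularCurve_heegnerVector) (hMaz : mazur_not_dvd_maninConstant_of_odd)
    (hD : KellerYin2024.thmD_imcMult_exists_isBDPLFunction_isTorsion_charIdeal_eq_OPEN)
    (W : WeierstrassCurve ℚ) [W.IsElliptic] [W.IsGloballyMinimal] (p : ℕ) [Fact p.Prime] (hc : X2.CellB W p)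
    (K : Type) [Field K] [NumberField K] (hK : IsImaginaryQuadratic K)
    (hHN : SatisfiesHeegnerHypothesis (W.conductorNorm ℤ) K) (hHp : SatisfiesHeegnerHypothesis p K)
    (hoddK : Odd (NumberField.discr K)) (hlt : NumberField.discr K < -4)
    (hr1 : (W.quadraticTwist (NumberField.discr K : ℚ)).analyticRank = 1)
    (Wd : WeierstrassCurve ℚ) [Wd.IsElliptic] [Wd.IsGloballyMinimal]
    (hWd : ∃ C : VariableChange ℚ, C • Wd = W.quadraticTwist (NumberField.discr K : ℚ))
    (K'' : Type) [Field K''] [NumberField K''] (hK'' : IsImaginaryQuadratic K'')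
    (hodd'' : Odd (NumberField.discr K'')) (hlt'' : NumberField.discr K'' < -4)
    (hHN'' : SatisfiesHeegnerHypothesis (Wd.conductorNorm ℤ) K'') (hHp'' : SatisfiesHeegnerHypothesis p K'')
    (hL'' : (Wd.quadraticTwist (NumberField.discr K'' : ℚ)).entireLFunction 1 ≠ 0)
    (W'' : WeierstrassCurve ℚ) [W''.IsElliptic] [W''.IsGloballyMinimal]
    (hW'' : ∃ C : VariableChange ℚ, C • W'' = Wd.quadraticTwist (NumberField.discr K'' : ℚ))
    (hbsd'' : BSDp W'' p) : BSDp W p := by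
  obtain ⟨C, hC⟩ := hWd
  have hrd : Wd.analyticRank = 1 := by
    have h := congrArg WeierstrassCurve.analyticRank hC
    rw [analyticRank_smul] at h
    exact h.trans hr1
  exact bsdp_of_cellB_of_bsdp_partnerAt hP hPT hPT2 hH hF hMaz hD W p hc K hK hHN hHp hoddK hlt hr1 Wd ⟨C, hC⟩
    (bsdp_partner_of_twoStepBSDp hP hPT hPT2 hH hF hMaz hD W p hc.2.1 K hK hHp Wd ⟨C, hC⟩ hrd K'' hK'' hodd'' hlt''
      hHN'' hHp'' hL'' W'' hW'' hbsd'')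

/-- **TWO-STEP TRANSFER of Mazur's main conjecture**: with the data of `bsdp_of_cellB_of_twoStepBSDp`, the main conjecture at
the X2b-type rank-zero pair `(W″, p)` (`X2.MazurMainConjectureAt W″ p`; `W″` is X2 at `p` by `X2.classX2_twist` twice and has
analytic rank `0` since `L(W″,1) = L(Wd^{(d_{K″})},1) ≠ 0`) gives the main conjecture at `(W, p)`:
`X2.bsdp_of_mazurMainConjectureAt_of_analyticRank_eq_zero` at `W″`, the transfer, `X2.mazurMainConjectureAt_of_bsdp_of_red`
at `W`. CONDITIONAL; a main conjecture is proved for no curve by this. [claim: KellerYin2024, status: under-review]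
[cite: Wuthrich2014, Thm. 16 and §5 (p. 397)] [cite: SteinWuthrich2013, Thm. 6.1 (p. 20)] [cite: Miller2011LMS, Def. 1.1] -/
theorem mazurMainConjectureAt_of_cellB_of_twoStep_mazurMainConjectureAt (hP : EisensteinPrimes.PublishedInputs)
    (hPT : ∀ (K : Type) [Field K] [NumberField K], poitouTate_selmerStructure_duality K)
    (hPT2 : ∀ (K : Type) [Field K] [NumberField K], poitouTate_sha_tateDual K)
    (hH : hsieh2014_exists_anticyclotomicPAdicLFunction)
    (hF : LiuZhangZhang2018.thm151_thm153_modularCurve_heegnerVector) (hMaz : mazur_not_dvd_maninConstant_of_odd)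
    (hD : KellerYin2024.thmD_imcMult_exists_isBDPLFunction_isTorsion_charIdeal_eq_OPEN)
    (W : WeierstrassCurve ℚ) [W.IsElliptic] [W.IsGloballyMinimal] (p : ℕ) [Fact p.Prime] (hc : X2.CellB W p)
    (K : Type) [Field K] [NumberField K] (hK : IsImaginaryQuadratic K)
    (hHN : SatisfiesHeegnerHypothesis (W.conductorNorm ℤ) K) (hHp : SatisfiesHeegnerHypothesis p K)
    (hoddK : Odd (NumberField.discr K)) (hlt : NumberField.discr K < -4)
    (hr1 : (W.quadraticTwist (NumberField.discr K : ℚ)).analyticRank = 1)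
    (Wd : WeierstrassCurve ℚ) [Wd.IsElliptic] [Wd.IsGloballyMinimal]
    (hWd : ∃ C : VariableChange ℚ, C • Wd = W.quadraticTwist (NumberField.discr K : ℚ))
    (K'' : Type) [Field K''] [NumberField K''] (hK'' : IsImaginaryQuadratic K'')
    (hodd'' : Odd (NumberField.discr K'')) (hlt'' : NumberField.discr K'' < -4)
    (hHN'' : SatisfiesHeegnerHypothesis (Wd.conductorNorm ℤ) K'') (hHp'' : SatisfiesHeegnerHypothesis p K'')
    (hL'' : (Wd.quadraticTwist (NumberField.discr K'' : ℚ)).entireLFunction 1 ≠ 0)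
    (W'' : WeierstrassCurve ℚ) [W''.IsElliptic] [W''.IsGloballyMinimal]
    (hW'' : ∃ C : VariableChange ℚ, C • W'' = Wd.quadraticTwist (NumberField.discr K'' : ℚ))
    (hMC'' : X2.MazurMainConjectureAt W'' p) : X2.MazurMainConjectureAt W p := by
  have hpar := hP.2.2.2.2.1
  have hnf := hP.2.2.2.2.2.1
  have hGZK := hP.2.2.2.2.2.2.2.2.2.2.1
  have hWu := hP.2.2.2.2.2.2.2.2.2.2.2.2.2.2.1
  have hJs := hP.2.2.2.2.2.2.2.2.2.2.2.2.2.2.2.1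
  have hJn := hP.2.2.2.2.2.2.2.2.2.2.2.2.2.2.2.2.1
  have hHs := hP.2.2.2.2.2.2.2.2.2.2.2.2.2.2.2.2.2.1
  have hHn := hP.2.2.2.2.2.2.2.2.2.2.2.2.2.2.2.2.2.2.1
  have hGS := hP.2.2.2.2.2.2.2.2.2.2.2.2.2.2.2.2.2.2.2
  have hE : WeierstrassCurve.hasEntireLFunction_rat :=
    WeierstrassCurve.hasEntireLFunction_rat_of_exists_isNewformOf hnf
  -- `W″` is X2 at `p`, of analytic rank `0`
  have hXd : ClassX2 Wd p := X2.classX2_twist W p hc.2.1 K hK hHp Wd hWd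
  have hX'' : ClassX2 W'' p := X2.classX2_twist Wd p hXd K'' hK'' hHp'' W'' hW''
  obtain ⟨C'', hC''⟩ := hW''
  have hL1 : W''.entireLFunction 1 ≠ 0 := by
    rw [← entireLFunction_smul W'' C'', hC'']; exact hL''
  have hr'' : W''.analyticRank = 0 := (W''.analyticRank_eq_zero_iff_holds (hE W'')).2 hL1
  have hbsd'' : BSDp W'' p :=
    X2.bsdp_of_mazurMainConjectureAt_of_analyticRank_eq_zero hJs hJn hHs hHn hGZK hE hpar W'' p (hGS W'' p) hX''.1
      hX''.2.2 hr'' hMC''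
  exact X2.mazurMainConjectureAt_of_bsdp_of_red hWu hJs hJn hHs hHn hGZK hE W p (hGS W p) hc.2.1.1 hc.2.1.2.2
    hc.2.1.2.1 hc.1
    (bsdp_of_cellB_of_twoStepBSDp hP hPT hPT2 hH hF hMaz hD W p hc K hK hHN hHp hoddK hlt hr1 Wd hWd K'' hK'' hodd''
      hlt'' hHN'' hHp'' hL'' W'' ⟨C'', hC''⟩ hbsd'')

end Summit.BirchSwinnertonDyer.BirchSwinnertonDyer.Theorems.EisensteinPrimesMazurMCOnCellBTwistbackOnePartnerAt

end
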